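import Mathlib
import Summits.Ventures.HodgeRepro.Tier4.Target
import Summits.Ventures.HodgeRepro.Tier4.Line3.Defs
import Summits.Ventures.HodgeRepro.Tier4.Line3.DefsLemmas
import Summits.Ventures.HodgeRepro.Tier4.Line3.ScalarFamily
import Summits.Ventures.HodgeRepro.Tier4.Line3.UnitCopyScaling
import Summits.Ventures.HodgeRepro.Tier4.Line3.UnitCopySphere

/-!
# Tier4/Line3/CopyRemainder — the remainder of the scalar family split into the copies of the centre and the rest
Blind re-derivation cell `pub-hodge-repro`, Tier 4 «PROVE THE STEP», LINE L3, planned by seat t4-plan-3 (g3) for v0.41 of the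
skeleton (bus S13642: the `N`-free reduction covers ONLY the copies of the centre's own orbit; the rest of the family stays a
displayed open local statement).  Definitions only plus ONE Mathlib-level theorem:
* `Copies S xm`: the per-slot scalar copies of the centre by the admissible scalar tuples `S`; `copies_subset_scalarFamily`,
  `orbitOf_lines_mem_copies` (`1 ∈ S`);
* `RemainderCopies D S xm loc θ₁` (R-a) and `RemainderOff D S xm loc θ₂` (R-b): the two halves of the skeleton's `Remainder`;
* **`remainder_of_copies_off`**: `θ₁ + θ₂ < 1` and both halves give the skeleton's `Remainder` (indicator split + triangle inequality);
* `CopyData D S xm` (representatives with their sphere phases, `SphereScalarSymmetric` of p681393), `CopyData.weight` (the `N`-free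
  weight `|I_∞^ε| · |Λ| · gaussRatio`), `ArchCopyBound D S xm c θ₁` (R-a′: the archimedean count on the data).
The theorem `remainderCopies_of_archCopyBound : ArchCopyBound → RemainderCopies` (via `term_smul_family_of_sphere`) is the CUT
offered to t4-x2 (bus); it is NOT in this module.
Nothing here says anything about the status of the Hodge conjecture for CM abelian varieties, which is NOT proved
(HC_CM is NOT proved by anyone in this repository).
-/

set_option autoImplicit false

noncomputable section

namespace Summit.Ventures.HodgeRepro.Tier4.Line3

open Summit.Ventures.HodgeRepro.Tier4
open Matrix MeasureTheory NumberField
open Filter Topology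
open scoped ComplexConjugate
open scoped Classical

/-! ## The remainder split: the copies of the centre vs the rest of the family.

`ScalarFamily xm` (ScalarFamily.lean L86–L88) is the set of per-slot scalar copies of EVERY tuple on the Gram ray — the copies of every
`U(V)(E)`-translate of `xm` in every `Γ`-orbit.  On the COPIES OF THE CENTRE `Copies xm = {orbitOf (lines (ε • xm))}` the ratio to the main
term is `N`-free (t4-x2 `Line3.ScalarCopyClassSum` p682146 / `ScalarCopyClassSumSphere`: `term_N(ε • xm) = I_∞^ε · Λ(ε) · gaussRatio(ε, xm) ·
classSum_N(xm)` under the sphere symmetry of t4-L3-p2's `Line3.UnitCopySphere` p681393), so the `remainder` over the copies reduces to an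
ARCHIMEDEAN COUNT on the data (`ArchCopyBound`: `Σ_{ε ≠ 1} |I_∞^ε| |Λ(ε)| gaussRatio(ε, xm) ≤ θ₁ · Re I_∞(xm)`, `N`-free); on the rest of
the family (`RemainderOff`) neither L3.4″ nor L3.5″ says anything (both are OFF the family) and the only handle is `SuppU4` — an open local
statement, DISPLAYED.  `remainder_of_copies_off` glues the two with `θ = θ₁ + θ₂` (its conclusion is the skeleton's `Remainder D xm loc` of LINE L3 v0.40, spelled out). -/
namespace T4Data

variable (X : T4Data)

/-- the per-slot scalar copies of the centre's orbit by the ADMISSIBLE scalar tuples `S` (on the natural data: integral, prime to the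
bad places — the scalars for which t4-L3-p2's sphere symmetry is displayed, `NaturalSlotSymmetric`; the copies by the other scalars
stay in `RemainderOff`) -/
def Copies (S : Set (Fin 4 → X.E)) (xm : X.Tuple) : Set X.Orbit :=
  {o | ∃ ε ∈ S, (∀ j, ε j ≠ 0) ∧ X.orbitOf (X.lines (fun j => ε j • xm j)) = o}

/-- the copies of the centre lie in the scalar family (`y := xm`, `ρ := 1`) -/
theorem copies_subset_scalarFamily (S : Set (Fin 4 → X.E)) (xm : X.Tuple) : X.Copies S xm ⊆ X.ScalarFamily xm := by
  rintro o ⟨ε, -, hε, rfl⟩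
  exact ⟨xm, ε, 1, hε, fun i j => by simp, rfl⟩

/-- the main orbit is a copy when `1 ∈ S` -/
theorem orbitOf_lines_mem_copies {S : Set (Fin 4 → X.E)} (h1 : (fun _ => (1 : X.E)) ∈ S) (xm : X.Tuple) :
    X.orbitOf (X.lines xm) ∈ X.Copies S xm :=
  ⟨fun _ => 1, h1, fun _ => one_ne_zero, by simp⟩

/-- (R-a) the copies of the centre minus the main orbit are eventually `≤ θ₁ · Re(term main)` -/
def RemainderCopies (D : X.ThetaData) (S : Set (Fin 4 → X.E)) (xm : X.Tuple) {level : ℕ → X.Level}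
    (loc : ∀ N : ℕ, X.Tr (level N)) (θ₁ : ℝ) : Prop :=
  ∀ᶠ N in atTop,
    ‖∑' o, if o ∈ X.Copies S xm ∧ o ≠ X.orbitOf (X.lines xm) then X.term D.Φ D.cf (level N) (loc N) o else 0‖ ≤
      θ₁ * (X.term D.Φ D.cf (level N) (loc N) (X.orbitOf (X.lines xm))).re

/-- (R-b) the family minus the copies of the centre is eventually `≤ θ₂ · Re(term main)` — DISPLAYED (the open local statement) -/
def RemainderOff (D : X.ThetaData) (S : Set (Fin 4 → X.E)) (xm : X.Tuple) {level : ℕ → X.Level}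
    (loc : ∀ N : ℕ, X.Tr (level N)) (θ₂ : ℝ) : Prop :=
  ∀ᶠ N in atTop,
    ‖∑' o, if o ∈ X.ScalarFamily xm ∧ o ∉ X.Copies S xm then X.term D.Φ D.cf (level N) (loc N) o else 0‖ ≤
      θ₂ * (X.term D.Φ D.cf (level N) (loc N) (X.orbitOf (X.lines xm))).re

/-- **THE REMAINDER FROM ITS TWO HALVES (a THEOREM):** `θ := θ₁ + θ₂`; the family minus the main orbit is the copies minus the main
orbit plus the family minus the copies (pointwise identity of the indicator sums; summability from the expansion), then the triangle
inequality. -/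
theorem remainder_of_copies_off (D : X.ThetaData) {S : Set (Fin 4 → X.E)} (hS : (fun _ => (1 : X.E)) ∈ S) {xm : X.Tuple}
    {level : ℕ → X.Level} (loc : ∀ N : ℕ, X.Tr (level N))
    (E : OrbitExpansion X.Orbit X.pairing (X.term D.Φ D.cf)) {θ₁ θ₂ : ℝ} (hθ : θ₁ + θ₂ < 1)
    (h1 : X.RemainderCopies D S xm loc θ₁) (h2 : X.RemainderOff D S xm loc θ₂) :
    ∃ θ : ℝ, θ < 1 ∧ ∀ᶠ N in atTop,
      ‖∑' o, if o ∈ X.ScalarFamily xm ∧ o ≠ X.orbitOf (X.lines xm) then X.term D.Φ D.cf (level N) (loc N) o else 0‖ ≤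
        θ * (X.term D.Φ D.cf (level N) (loc N) (X.orbitOf (X.lines xm))).re := by
  refine ⟨θ₁ + θ₂, hθ, ?_⟩
  filter_upwards [h1, h2] with N hc ho
  have hs : Summable fun o => ‖X.term D.Φ D.cf (level N) (loc N) o‖ := E.summable_norm (level N) (loc N)
  have hA : Summable fun o : X.Orbit =>
      if o ∈ X.Copies S xm ∧ o ≠ X.orbitOf (X.lines xm) then X.term D.Φ D.cf (level N) (loc N) o else 0 := by
    refine Summable.of_norm_bounded hs ?_
    intro o
    split_ifs <;> simp
  have hB : Summable fun o : X.Orbit =>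
      if o ∈ X.ScalarFamily xm ∧ o ∉ X.Copies S xm then X.term D.Φ D.cf (level N) (loc N) o else 0 := by
    refine Summable.of_norm_bounded hs ?_
    intro o
    split_ifs <;> simp
  have hsplit : (∑' o : X.Orbit, if o ∈ X.ScalarFamily xm ∧ o ≠ X.orbitOf (X.lines xm) then
        X.term D.Φ D.cf (level N) (loc N) o else 0) =
      (∑' o : X.Orbit, if o ∈ X.Copies S xm ∧ o ≠ X.orbitOf (X.lines xm) then
        X.term D.Φ D.cf (level N) (loc N) o else 0) +
      ∑' o : X.Orbit, if o ∈ X.ScalarFamily xm ∧ o ∉ X.Copies S xm then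
        X.term D.Φ D.cf (level N) (loc N) o else 0 := by
    rw [← hA.tsum_add hB]
    refine tsum_congr fun o => ?_
    by_cases hC : o ∈ X.Copies S xm
    · have hF : o ∈ X.ScalarFamily xm := X.copies_subset_scalarFamily S xm hC
      by_cases hm : o = X.orbitOf (X.lines xm)
      · subst hm
        simp [X.orbitOf_lines_mem_copies hS xm]
      · simp [hC, hF, hm]
    · have hm : o ≠ X.orbitOf (X.lines xm) := fun h => hC (h ▸ X.orbitOf_lines_mem_copies hS xm)
      by_cases hF : o ∈ X.ScalarFamily xm
      · simp [hC, hF, hm]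
      · simp [hC, hF]
  rw [hsplit]
  calc ‖(∑' o : X.Orbit, if o ∈ X.Copies S xm ∧ o ≠ X.orbitOf (X.lines xm) then
          X.term D.Φ D.cf (level N) (loc N) o else 0) +
        ∑' o : X.Orbit, if o ∈ X.ScalarFamily xm ∧ o ∉ X.Copies S xm then
          X.term D.Φ D.cf (level N) (loc N) o else 0‖
      ≤ ‖∑' o : X.Orbit, if o ∈ X.Copies S xm ∧ o ≠ X.orbitOf (X.lines xm) then
          X.term D.Φ D.cf (level N) (loc N) o else 0‖ +
        ‖∑' o : X.Orbit, if o ∈ X.ScalarFamily xm ∧ o ∉ X.Copies S xm then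
          X.term D.Φ D.cf (level N) (loc N) o else 0‖ := norm_add_le _ _
    _ ≤ θ₁ * (X.term D.Φ D.cf (level N) (loc N) (X.orbitOf (X.lines xm))).re +
        θ₂ * (X.term D.Φ D.cf (level N) (loc N) (X.orbitOf (X.lines xm))).re := add_le_add hc ho
    _ = (θ₁ + θ₂) * (X.term D.Φ D.cf (level N) (loc N) (X.orbitOf (X.lines xm))).re := by ring

/-- **THE ARCHIMEDEAN DATUM OF THE COPIES:** a choice of scalar representatives of the copies with their sphere phases
(`SphereScalarSymmetric`, t4-L3-p2 p681393). -/
structure CopyData (D : X.ThetaData) (S : Set (Fin 4 → X.E)) (xm : X.Tuple) where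
  /-- the admissible scalar tuple representing the copy `o` -/
  rep : X.Orbit → (Fin 4 → X.E)
  rep_mem : ∀ o ∈ X.Copies S xm, rep o ∈ S
  /-- the per-slot phase of the copy `o` (`κ_j(rep o j)`: the geometric sums of `Line3.SlotGeometricSum` p682309 on the natural data) -/
  lam : X.Orbit → Fin 4 → ℂ
  rep_ne : ∀ o ∈ X.Copies S xm, ∀ j, rep o j ≠ 0
  rep_orbit : ∀ o ∈ X.Copies S xm, X.orbitOf (X.lines (fun j => rep o j • xm j)) = o
  symm : ∀ o ∈ X.Copies S xm, ∀ j, X.SphereScalarSymmetric D xm j (rep o j) (lam o j)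

/-- the `N`-free weight of the copy `o`: `|I_∞^{rep o}| · |Λ(o)| · gaussRatio(rep o, xm)` -/
noncomputable def CopyData.weight {X : T4Data} {D : X.ThetaData} {S : Set (Fin 4 → X.E)} {xm : X.Tuple} (c : X.CopyData D S xm)
    (o : X.Orbit) : ℝ :=
  ‖∫ z in ball, ((X.kernelScale (c.rep o) xm z : ℝ) : ℂ) * X.kernel D.Φ xm z‖ *
    ‖c.lam o 0 * c.lam o 1 * conj (c.lam o 2 * c.lam o 3)‖ * X.gaussRatio (c.rep o) xm

/-- **(R-a′) THE ARCHIMEDEAN COUNT ON THE DATA, `N`-FREE:** the weights of the copies other than the main orbit are summable with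
sum `≤ θ₁ · Re I_∞(xm)`. -/
def ArchCopyBound (D : X.ThetaData) (S : Set (Fin 4 → X.E)) (xm : X.Tuple) (c : X.CopyData D S xm) (θ₁ : ℝ) : Prop :=
  Summable (fun o => if o ∈ X.Copies S xm ∧ o ≠ X.orbitOf (X.lines xm) then c.weight o else 0) ∧
    ∑' o, (if o ∈ X.Copies S xm ∧ o ≠ X.orbitOf (X.lines xm) then c.weight o else 0) ≤
      θ₁ * (∫ z in ball, X.kernel D.Φ xm z).re

end T4Data

end Summit.Ventures.HodgeRepro.Tier4.Line3
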